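import Mathlib
import HarnessLib
import Summits.HubbardSuperconductivity.HubbardSuperconductivity.Theorems.KLProgrammeKLRegimeTwoPointLimitCooperResummation
import Summits.HubbardSuperconductivity.HubbardSuperconductivity.Theorems.KLProgrammeKLRegimeSplitLegStaging
import Summits.HubbardSuperconductivity.HubbardSuperconductivity.Theorems.KLProgrammeKLRegimeSplitPairLadder

/-!
# Route `KLProgramme` — crux K3, engine child `KLRegimeEngineV7` (stmt-HubbardSuperconductivity-19662): the RESUMMATION-SIDE half of
# the pair-ladder step (E2-v5) — the implicit-step matrix `N` with `(1 + diag w · 𝒞_{n-1})·N = 1` EXISTS and `𝒞_{n-1}·N` is entrywise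
# `≤ 6·(2|U| + D·U²)` on the ball, from the history's split slot `PairArrayAtV2 (n-1)` alone

Cell gate-hubbard-kl, seat hubbard-kl-k3c1-p2 (child-1 row, Cooper-resummation toolkit; supply lemma for the engine child's provers
k3c2-p1, k3c2-p2, k3c2-p3, p1b).  The engine's one-step Cooper clause `PairLadderStepAtV5 … n` (`n ≥ 1`, module `…SplitLegStaging`) asks, for a
pair-class total momentum `Qm`, for scale-`n` bubble weights `w ≥ 0` (`Σ w ≤ bhi`) AND a matrix `N` on the torus carrier with
`(1 + Matrix.diagonal w * klPairArray … (n-1) Qm) * N = 1`, against which the new array `𝒞_n` is compared (`‖𝒞_n(k,k') − (𝒞_{n-1}N)(k,k')‖ ≤`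
remainder).  The matrix `1 + diag w · 𝒞_{n-1}` is NOT invertible for an arbitrary array (attractive arrays hit the BCS pole); what makes it
invertible is exactly what the history hands the engine at scale `n`: the split slot `PairArrayAtV2 … (n-1)` of `HistP` — on the ball
`𝒞_{n-1}(k,k') = u + O(D·U²)` with a REPULSIVE constant `u ∈ [0, 2|U|]`, `D = P.C_W + klLegKappa·Q.CR·P.Klam³` — together with the
smallness `bhi·D·U² ≤ 1/3` (a `U ≤ U₀(P,Q)` condition, available to `EngineP3` since `U₀` is chosen after `Q`).  This file proves that
bridge once, so that every engine proof can open (E2-v5) with `obtain ⟨N, hN, hCN⟩ := klEngine_resummation_exists …` and spend its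
effort on the remainder.

§1 (abstract, any finite carrier `S`, sub-carrier `B : Finset S`): `klres_push_through` (`(1 + D A) N = 1`, `1 + A D` a unit ⟹
`A N = (1 + A D)⁻¹ A`); **`klres_exists_rightInverse`**: `𝒞` supported on `B × B` with `|𝒞(s,t) − u| ≤ δ` there (`u, δ ≥ 0`), weights
`w ≥ 0` with `(Σ_{s∈B} w_s)·δ ≤ 1/3` ⟹ `∃ N, (1 + diag w · 𝒞)·N = 1 ∧ ∀ s t ∈ B, |(𝒞N)(s,t)| ≤ 6(u + δ)` — p1's Sherman–Morrison +
Neumann theorem `klcr_resummed_entry_le` (`…CooperResummation`, p436217) on the sub-carrier `↥B`, the determinant identity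
`det(1 + XY) = det(1 + YX)` to pass from `1 + 𝒞·diag w` to `1 + diag w·𝒞`, and an explicit block lift (`N = N_B ⊕ 1`).
§2 (model): **`klEngine_resummation_exists`**: `PairArrayAtV2 L M P Q β U μ K m` + `w ≥ 0` + `(Σ w)·D·U² ≤ 1/3` ⟹ for every `Qm`,
`∃ N, (1 + diag w · klPairArray … m Qm)·N = 1 ∧ ∀ k k' ∈ klBall, ‖(klPairArray … m Qm · N) k k'‖ ≤ 6·(2|U| + D·U²)`.
Everything is proved; no definitions; nothing is asserted about the model beyond this implication.
-/

noncomputable section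

namespace Summit.HubbardSuperconductivity.HubbardSuperconductivity.Theorems.KLRegimeSplit

set_option linter.dupNamespace false -- summit = problem name (single-conjunct summit), D-0017

open Finset Matrix Literature.MathematicalPhysics.QuantumLattice Literature.Probability.LatticeModels
open Summit.HubbardSuperconductivity.HubbardSuperconductivity.Theorems.KLProgrammeCooperResummation

/-! ## §1 Abstract finite-carrier form -/

section Abstract

variable {S : Type*} [Fintype S] [DecidableEq S]

/-- **Push-through.**  If `1 + A·D` is a unit and `(1 + D·A)·N = 1`, then `A·N = (1 + A·D)⁻¹·A`. -/
theorem klres_push_through (A D N : Matrix S S ℂ) (hAD : IsUnit (1 + A * D)) (hN : (1 + D * A) * N = 1) :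
    A * N = (1 + A * D)⁻¹ * A := by
  have hdet : IsUnit (1 + A * D).det := (Matrix.isUnit_iff_isUnit_det _).1 hAD
  have h1 : (1 + A * D) * (A * N) = A := by
    calc (1 + A * D) * (A * N) = A * ((1 + D * A) * N) := by noncomm_ring
      _ = A := by rw [hN, mul_one]
  calc A * N = (1 + A * D)⁻¹ * ((1 + A * D) * (A * N)) := by
        rw [← Matrix.mul_assoc, Matrix.nonsing_inv_mul _ hdet, Matrix.one_mul]
    _ = (1 + A * D)⁻¹ * A := by rw [h1]

/-- **The implicit-step matrix exists and the resummed array is entrywise bounded** (abstract form).  `𝒞` is supported on `B × B`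
and is a repulsive constant `u ≥ 0` up to `δ` there; the weights are `w ≥ 0` with `(Σ_{s ∈ B} w_s)·δ ≤ 1/3`.  Then there is `N` with
`(1 + diag w · 𝒞)·N = 1`, and `|(𝒞·N)(s,t)| ≤ 6·(u + δ)` for `s, t ∈ B`. -/
theorem klres_exists_rightInverse (B : Finset S) (w : S → ℝ) (hw : ∀ s, 0 ≤ w s) {u δ : ℝ} (hu : 0 ≤ u) (hδ : 0 ≤ δ)
    (𝒞 : Matrix S S ℂ) (hrow : ∀ s, s ∉ B → ∀ t, 𝒞 s t = 0) (hcol : ∀ t, t ∉ B → ∀ s, 𝒞 s t = 0)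
    (hdev : ∀ s ∈ B, ∀ t ∈ B, ‖𝒞 s t - u‖ ≤ δ) (hθ : (∑ s ∈ B, w s) * δ ≤ 1 / 3) :
    ∃ N : Matrix S S ℂ, (1 + Matrix.diagonal (fun s => (w s : ℂ)) * 𝒞) * N = 1 ∧
      ∀ s ∈ B, ∀ t ∈ B, ‖(𝒞 * N) s t‖ ≤ 6 * (u + δ) := by
  -- the degenerate case `B = ∅`: `𝒞 = 0`, `N = 1`
  rcases B.eq_empty_or_nonempty with hB | hB
  · subst hB
    have h𝒞0 : 𝒞 = 0 := by
      ext s t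
      exact hrow s (Finset.notMem_empty s) t
    refine ⟨1, ?_, fun s hs => absurd hs (Finset.notMem_empty s)⟩
    rw [h𝒞0, Matrix.mul_zero, add_zero, Matrix.one_mul]
  haveI : Nonempty ↥B := hB.coe_sort
  -- the sub-carrier `↥B`
  set wB : ↥B → ℝ := fun s => w s.1 with hwB_def
  have hwB : ∀ s, 0 ≤ wB s := fun s => hw s.1
  set A : Matrix ↥B ↥B ℂ := fun s t => 𝒞 s.1 t.1 with hA_def
  set 𝒟 : Matrix ↥B ↥B ℂ := A - Matrix.of (fun _ _ : ↥B => (u : ℂ)) with h𝒟_def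
  have h𝒟 : ∀ s t, ‖𝒟 s t‖ ≤ δ := fun s t => by
    simpa [h𝒟_def, hA_def] using hdev s.1 s.2 t.1 t.2
  have hWB : ∑ s : ↥B, wB s = ∑ s ∈ B, w s := Finset.sum_coe_sort B w
  have hθ' : (1 : ℝ) * (∑ s : ↥B, wB s) * δ ≤ 1 / 3 := by rw [one_mul, hWB]; exact hθ
  obtain ⟨hunit, hentry⟩ := klcr_resummed_entry_le wB hwB hu zero_le_one hδ 𝒟 h𝒟 hθ'
  have hJA : Matrix.of (fun _ _ : ↥B => (u : ℂ)) + 𝒟 = A := by rw [h𝒟_def]; abel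
  set Dw : Matrix ↥B ↥B ℂ := Matrix.diagonal (fun s => (wB s : ℂ)) with hDw_def
  rw [Complex.ofReal_one, one_smul, hJA] at hunit hentry
  -- `1 + Dw·A` is a unit too (determinant identity), its inverse `NB`, and push-through
  have hdet : IsUnit (1 + Dw * A).det := by
    rw [Matrix.det_one_add_mul_comm]
    exact (Matrix.isUnit_iff_isUnit_det _).1 hunit
  set NB : Matrix ↥B ↥B ℂ := (1 + Dw * A)⁻¹ with hNB_def
  have hNB : (1 + Dw * A) * NB = 1 := Matrix.mul_nonsing_inv _ hdet
  have hANB : A * NB = (1 + A * Dw)⁻¹ * A := klres_push_through A Dw NB hunit hNB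
  have hNBentry : ∀ s t : ↥B, NB s t + (wB s : ℂ) * (A * NB) s t = (1 : Matrix ↥B ↥B ℂ) s t := by
    intro s t
    have h := congrFun (congrFun hNB s) t
    rw [Matrix.add_mul, Matrix.one_mul, Matrix.mul_assoc, Matrix.add_apply, hDw_def, Matrix.diagonal_mul] at h
    exact h
  -- the block lift `N = NB ⊕ 1`
  set N : Matrix S S ℂ := fun s t => if h : s ∈ B ∧ t ∈ B then NB ⟨s, h.1⟩ ⟨t, h.2⟩ else (1 : Matrix S S ℂ) s t
    with hN_def
  -- `𝒞·N` vanishes off `B × B` and is `A·NB` on it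
  have hCN : ∀ s t, (𝒞 * N) s t = if h : s ∈ B ∧ t ∈ B then (A * NB) ⟨s, h.1⟩ ⟨t, h.2⟩ else 0 := by
    intro s t
    by_cases ht : t ∈ B
    · by_cases hs : s ∈ B
      · rw [dif_pos ⟨hs, ht⟩, Matrix.mul_apply, Matrix.mul_apply]
        have h1 : ∑ r, 𝒞 s r * N r t = ∑ r ∈ B, 𝒞 s r * N r t := by
          refine (Finset.sum_subset (Finset.subset_univ B) fun r _ hr => ?_).symm
          rw [hcol r hr s, zero_mul]
        rw [h1, ← Finset.sum_coe_sort B]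
        refine Finset.sum_congr rfl fun r _ => ?_
        have hr : (r : S) ∈ B := r.2
        simp only [hN_def, dif_pos (And.intro hr ht), hA_def]
      · rw [dif_neg (fun h => hs h.1), Matrix.mul_apply]
        exact Finset.sum_eq_zero fun r _ => by rw [hrow s hs r, zero_mul]
    · rw [dif_neg (fun h => ht h.2), Matrix.mul_apply]
      have h1 : ∀ r, N r t = (1 : Matrix S S ℂ) r t := fun r => by
        simp only [hN_def, dif_neg (fun h : r ∈ B ∧ t ∈ B => ht h.2)]
      simp_rw [h1]
      rw [← Matrix.mul_apply, Matrix.mul_one]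
      exact hcol t ht s
  refine ⟨N, ?_, fun s hs t ht => ?_⟩
  · ext s t
    rw [Matrix.add_mul, Matrix.one_mul, Matrix.mul_assoc, Matrix.add_apply, Matrix.diagonal_mul, hCN s t]
    by_cases h : s ∈ B ∧ t ∈ B
    · rw [dif_pos h]
      have hNst : N s t = NB ⟨s, h.1⟩ ⟨t, h.2⟩ := by simp only [hN_def, dif_pos h]
      rw [hNst, hNBentry ⟨s, h.1⟩ ⟨t, h.2⟩]
      simp only [Matrix.one_apply, Subtype.mk.injEq]
    · rw [dif_neg h, mul_zero, add_zero]
      simp only [hN_def, dif_neg h]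
  · rw [hCN s t, dif_pos ⟨hs, ht⟩, hANB]
    exact hentry ⟨s, hs⟩ ⟨t, ht⟩

end Abstract

/-! ## §2 The engine-side corollary on the torus carrier -/

section Model

variable (L M : ℕ) [NeZero L] [NeZero M]

/-- **The resummation-side half of (E2-v5).**  If the history's split slot gives `PairArrayAtV2 … m` (the scale-`m` pair arrays are a
repulsive constant `u ∈ [0, 2|U|]` up to `D·U²` on the ball, `D = P.C_W + klLegKappa·Q.CR·P.Klam³`), then for ANY weights `w ≥ 0`
whose total mass satisfies `(Σ w)·D·U² ≤ 1/3` and every total momentum `Qm` there is a matrix `N` with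
`(1 + diag w · klPairArray … m Qm)·N = 1`, and the resummed array `klPairArray … m Qm · N` is entrywise `≤ 6·(2|U| + D·U²)` on the ball.
(The engine uses it at `m = n − 1` with its scale-`n` bubble weights, `Σ w ≤ bhi`, under `bhi·D·U² ≤ 1/3` from `U ≤ U₀(P,Q)`.) -/
theorem klEngine_resummation_exists {P : SplitConsts} {Q : EngConsts} {β U μ : ℝ} {K : TrigPolyC4v} {m : ℕ}
    (hsplit : PairArrayAtV2 L M P Q β U μ K m) (w : TorusSite 2 L → ℝ) (hw : ∀ p, 0 ≤ w p)
    (hθ : (∑ p, w p) * ((P.C_W + klLegKappa * Q.CR * P.Klam ^ 3) * U ^ 2) ≤ 1 / 3)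
    (hD : 0 ≤ P.C_W + klLegKappa * Q.CR * P.Klam ^ 3) (Qm : TorusSite 2 L) :
    ∃ N : Matrix (TorusSite 2 L) (TorusSite 2 L) ℂ,
      (1 + Matrix.diagonal (fun p => (w p : ℂ)) * klPairArray L M β U μ K m Qm) * N = 1 ∧
      ∀ k ∈ klBall L μ K, ∀ k' ∈ klBall L μ K,
        ‖(klPairArray L M β U μ K m Qm * N) k k'‖ ≤ 6 * (2 * |U| + (P.C_W + klLegKappa * Q.CR * P.Klam ^ 3) * U ^ 2) := by
  obtain ⟨u, hu0, hu2, hball⟩ := hsplit Qm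
  set δ : ℝ := (P.C_W + klLegKappa * Q.CR * P.Klam ^ 3) * U ^ 2 with hδ_def
  have hδ : 0 ≤ δ := mul_nonneg hD (sq_nonneg U)
  have hrow : ∀ s, s ∉ klBall L μ K → ∀ t, klPairArray L M β U μ K m Qm s t = 0 :=
    fun s hs t => klPairArray_apply_of_not_mem L M β U μ K m Qm hs t
  have hcol : ∀ t, t ∉ klBall L μ K → ∀ s, klPairArray L M β U μ K m Qm s t = 0 :=
    fun t ht s => by simp [klPairArray, ht]
  have hdev : ∀ s ∈ klBall L μ K, ∀ t ∈ klBall L μ K, ‖klPairArray L M β U μ K m Qm s t - u‖ ≤ δ := by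
    intro s hs t ht
    rw [klPairArray_apply_of_mem L M β U μ K m Qm hs ht]
    exact hball s hs t ht
  have hθ' : (∑ s ∈ klBall L μ K, w s) * δ ≤ 1 / 3 := by
    have h1 : ∑ s ∈ klBall L μ K, w s ≤ ∑ s, w s :=
      Finset.sum_le_sum_of_subset_of_nonneg (Finset.subset_univ _) fun s _ _ => hw s
    exact (mul_le_mul_of_nonneg_right h1 hδ).trans hθ
  obtain ⟨N, hN, hent⟩ := klres_exists_rightInverse (klBall L μ K) w hw hu0 hδ _ hrow hcol hdev hθ'
  refine ⟨N, hN, fun k hk k' hk' => (hent k hk k' hk').trans ?_⟩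
  linarith

end Model

end Summit.HubbardSuperconductivity.HubbardSuperconductivity.Theorems.KLRegimeSplit

end
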